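import Literature.NumberTheory.EllipticCurves.IwasawaAlgebraPseudoNullProofs
import HarnessLib

/-!
# Pseudo-null ⟹ torsion; torsion passes along pseudo-isomorphisms; torsion of a module with involution from the torsion of
# its two sign-coinvariant quotients (module theory; THEOREMS ONLY)

`Proofs`-style sequel of `IwasawaAlgebra.lean` / `IwasawaAlgebraPseudoNullProofs.lean` (the tree's `Module.IsPseudoNull`,
`LinearMap.IsPseudoIsomorphism`).  THEOREMS ONLY (no definition, no named fact, no instance, no `sorry`); Mathlib-style commutative
algebra over a commutative domain `R`; nothing about elliptic curves is asserted.  Written for the BSD cell `bsd-print-cf2` (seat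
`bsd-line-cf2c-w7` g19, memo BRICK-C-FRAME-g19 §4 D5): the LEAD's assembly hypothesis `hUtor` («`U_∞/𝒞_∞` is torsion over `ℤ₂⟦T₁,T₂⟧`») is
to be read off the (c)-lane's identities for the two sign-coinvariant quotients `(N/C)_ε`, `ε = ±1`, which are PSEUDO-ISOMORPHIC to the cyclic
modules `Λ/(L_ε)` (`LubinTateColemanCoordCoinvariantCharTwo.isPseudoIsomorphism_colemanCoinvariantMap`); at `p = 2` the idempotents
`(1 ± σ)/2` do not exist, so the passage from the `ε`-parts to the whole module is the elementary annihilator argument (3) below.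

* (1) `Module.IsPseudoNull.isTorsion` — over a domain, a pseudo-null module is torsion (`M_{(0)} = 0`: localise at the height-`0` prime `(0)`);
* (2) `LinearMap.IsPseudoIsomorphism.isTorsion_of_isTorsion` / `….isTorsion_iff` — along `f : M → N` with pseudo-null kernel and cokernel,
  `M` is torsion iff `N` is;
* (3) ★ `Module.isTorsion_of_isTorsion_coinvariants_of_involution` — `σ² = 1`, `M/(σ − 1)M` and `M/(σ + 1)M` torsion ⟹ `M` torsion
  (`a·m = (σ−1)m₁`, `b·m₁ = (σ+1)m₂` ⟹ `ba·m = (σ−1)(σ+1)m₂ = 0`).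

## References

* N. Bourbaki, *Algèbre commutative*, Ch. VII §4.4 (pseudo-null modules, pseudo-isomorphisms). [BourbakiAC5to7]
* L. C. Washington, *Introduction to Cyclotomic Fields*, GTM 83, §13.2. [Washington1997]
* E. de Shalit, *Iwasawa theory of elliptic curves with complex multiplication* (1987), III §1.4 (5), Lemma 1.10 (17), §1.14. [deShalit1987]
-/

namespace Literature.NumberTheory.EllipticCurves

open scoped nonZeroDivisors

/-! ### (1) Pseudo-null modules over a domain are torsion -/

namespace Module

variable {R : Type*} [CommRing R] [IsDomain R] {M : Type*} [AddCommGroup M] [_root_.Module R M]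

/-- **A pseudo-null module over a domain is torsion**: `(0)` is a prime of height `0 ≤ 1`, so `M_{(0)} = 0`, i.e. every element is killed by a
non-zero scalar. [cite: BourbakiAC5to7, Ch. VII §4.4 Def. 2] -/
theorem IsPseudoNull.isTorsion (h : IsPseudoNull R M) : _root_.Module.IsTorsion R M := by
  have h0 := h ⟨(⊥ : Ideal R), Ideal.isPrime_bot⟩ (by rw [Ideal.height_bot]; exact zero_le_one)
  rw [LocalizedModule.subsingleton_iff] at h0
  intro x
  obtain ⟨r, hr, hrx⟩ := h0 x
  exact ⟨⟨r, mem_nonZeroDivisors_of_ne_zero (by simpa [Ideal.primeCompl] using hr)⟩, hrx⟩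

end Module

/-! ### (2) Torsion passes along pseudo-isomorphisms -/

namespace LinearMap

variable {R : Type*} [CommRing R] [IsDomain R] {M N : Type*} [AddCommGroup M] [_root_.Module R M] [AddCommGroup N] [_root_.Module R N]

/-- **`N` torsion ⟹ `M` torsion** along `f : M → N` with pseudo-null (hence torsion) kernel: `a·f m = 0 ⟹ a·m ∈ ker f ⟹ b·a·m = 0`.
[cite: BourbakiAC5to7, Ch. VII §4.4] -/
theorem IsPseudoIsomorphism.isTorsion_of_isTorsion {f : M →ₗ[R] N} (hf : IsPseudoIsomorphism f) (hN : _root_.Module.IsTorsion R N) :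
    _root_.Module.IsTorsion R M := by
  intro m
  obtain ⟨a, ha⟩ := @hN (f m)
  rw [Submonoid.smul_def] at ha
  have hker : (a : R) • m ∈ LinearMap.ker f := by
    rw [LinearMap.mem_ker, map_smul]
    exact ha
  have ht := Module.IsPseudoNull.isTorsion hf.1
  obtain ⟨b, hb⟩ := @ht ⟨(a : R) • m, hker⟩
  refine ⟨b * a, ?_⟩
  have hb' := congrArg Subtype.val hb
  rw [Submonoid.smul_def] at hb'
  simp only [SetLike.val_smul, ZeroMemClass.coe_zero] at hb'
  rw [Submonoid.smul_def, Submonoid.coe_mul, mul_smul]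
  exact hb'

/-- **`M` torsion ⟹ `N` torsion** along `f : M → N` with pseudo-null (hence torsion) cokernel: `a·n = f m`, `b·m = 0 ⟹ b·a·n = 0`.
[cite: BourbakiAC5to7, Ch. VII §4.4] -/
theorem IsPseudoIsomorphism.isTorsion_of_isTorsion' {f : M →ₗ[R] N} (hf : IsPseudoIsomorphism f) (hM : _root_.Module.IsTorsion R M) :
    _root_.Module.IsTorsion R N := by
  intro n
  have ht := Module.IsPseudoNull.isTorsion hf.2
  obtain ⟨a, ha⟩ := @ht (Submodule.Quotient.mk n : N ⧸ LinearMap.range f)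
  rw [Submonoid.smul_def, ← Submodule.Quotient.mk_smul, Submodule.Quotient.mk_eq_zero, LinearMap.mem_range] at ha
  obtain ⟨m, hm⟩ := ha
  obtain ⟨b, hb⟩ := @hM m
  rw [Submonoid.smul_def] at hb
  refine ⟨b * a, ?_⟩
  rw [Submonoid.smul_def, Submonoid.coe_mul, mul_smul, ← hm, ← map_smul, hb, map_zero]

/-- **Along a pseudo-isomorphism, `M` is torsion iff `N` is.** [cite: BourbakiAC5to7, Ch. VII §4.4] -/
theorem IsPseudoIsomorphism.isTorsion_iff {f : M →ₗ[R] N} (hf : IsPseudoIsomorphism f) :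
    _root_.Module.IsTorsion R M ↔ _root_.Module.IsTorsion R N :=
  ⟨hf.isTorsion_of_isTorsion', hf.isTorsion_of_isTorsion⟩

end LinearMap

/-! ### (3) Torsion of a module with involution from its two sign-coinvariant quotients -/

namespace Module

variable {R : Type*} [CommRing R] {M : Type*} [AddCommGroup M] [_root_.Module R M]

/-- ★ **Torsion from the two sign-coinvariant quotients**: for a linear `σ` with `σ² = 1` (a `Λ[Δ]`-module, `Δ = ℤ/2` — at `p = 2` the idempotents
`(1 ± σ)/2` are not available), if `M/(σ − 1)M` and `M/(σ + 1)M` are torsion then so is `M`: `a·m = (σ−1)m₁`, `b·m₁ = (σ+1)m₂`, and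
`(σ−1)(σ+1) = σ² − 1 = 0` give `(b·a)·m = 0`. [cite: Washington1997, §13.2] [cite: deShalit1987, III §1.14] -/
theorem isTorsion_of_isTorsion_coinvariants_of_involution (σ : M →ₗ[R] M) (hσ : σ.comp σ = LinearMap.id)
    (hplus : _root_.Module.IsTorsion R (M ⧸ LinearMap.range (σ - LinearMap.id)))
    (hminus : _root_.Module.IsTorsion R (M ⧸ LinearMap.range (σ + LinearMap.id))) :
    _root_.Module.IsTorsion R M := by
  intro m
  obtain ⟨a, ha⟩ := @hplus (Submodule.Quotient.mk m)
  rw [Submonoid.smul_def, ← Submodule.Quotient.mk_smul, Submodule.Quotient.mk_eq_zero, LinearMap.mem_range] at ha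
  obtain ⟨m₁, hm₁⟩ := ha
  obtain ⟨b, hb⟩ := @hminus (Submodule.Quotient.mk m₁)
  rw [Submonoid.smul_def, ← Submodule.Quotient.mk_smul, Submodule.Quotient.mk_eq_zero, LinearMap.mem_range] at hb
  obtain ⟨m₂, hm₂⟩ := hb
  refine ⟨b * a, ?_⟩
  have hσσ : ∀ x : M, σ (σ x) = x := fun x => by
    have := LinearMap.congr_fun hσ x
    simpa using this
  rw [Submonoid.smul_def, Submonoid.coe_mul, mul_smul, ← hm₁, ← map_smul, ← hm₂]
  simp only [LinearMap.sub_apply, LinearMap.add_apply, LinearMap.id_apply, map_add, hσσ]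
  abel

end Module

end Literature.NumberTheory.EllipticCurves
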